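import Mathlib
import Summits.ValiantsHypothesis.ValiantsHypothesis.Theorems.FifoMatchingNNLinearDegreeCofactorHardShedWordChain
import Summits.ValiantsHypothesis.ValiantsHypothesis.Theorems.FifoMatchingNNLinearDegreeCofactorHardShedWordHeartPopped
import Summits.ValiantsHypothesis.ValiantsHypothesis.Theorems.FifoMatchingNNLinearDegreeCofactorHardPassagePricingSucc
import HarnessLib

/-!
# Crux `NNLinearDegreeCofactorHard` (stmt-ValiantsHypothesis-23918), line `internal_cofactor`, stub S2b (ii):
# μ* = shedWord — the two ATTRIBUTION INEQUALITIES of the gate kind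

For a band bit string `y` (`|fairWalk| < w < F₀` on `[H, E]`) whose balanced word respects `S`:

* `exists_isTest_between` — **between two gates `j < j'` with a push at `j` (a FAILED gate) lies a test coin**: either the
  front is unchanged at `j'` (then `j'` is a second good exit of the same front period — `no_two_goodExits`), or the front was
  popped at `τ ∈ (j, j')`, the R-items of its chain were shed at the next non-defect positions (`chain`) with the front's colour,
  and `no_two_goodExits` applies to `τ`;  hence `card_failedGates_le` — **`F ≤ T + 1`** (`card_le_card_add_one_of_between`);
* `card_sBoundariesPopped_le` — **`P′ ≤ T + G + 1`**: every S-boundary item `k` popped before `E` with an S-item below it owns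
  the coin `φ k` = the pop time `τ` of its S-predecessor if that is a gate (then a PASSED gate: the bit is `D`), and otherwise
  the `(k - k₀)`-th non-defect position after `τ`, where `k` reaches the front, which is then a TEST; `φ` is strictly increasing.

With `CondProbBits.card_mul_le_of_passages_succ` this prices the respecting band words: `card_resp_mul_le_of_gates`.
Honest framing: bookkeeping; nothing here proves S2b, the crux or VP ≠ VNP (not proved).  No new definitions. [folklore]
-/

noncomputable section

-- Sub = Summit single-conjunct layout: the duplicated namespace component is mandated by the tree.
set_option linter.dupNamespace false

namespace Summit.ValiantsHypothesis.ValiantsHypothesis.Theorems.FifoMatching.NNLinearDegreeCofactorHard.ShedWord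

open Finset Literature.Computability.AlgebraicComplexity
open Summit.ValiantsHypothesis.ValiantsHypothesis.Theorems.FifoMatching.NNMonotoneHard
open Summit.ValiantsHypothesis.ValiantsHypothesis.Theorems.FifoMatching.NNLinearDegreeCofactorHard.QueueHistory
open Summit.ValiantsHypothesis.ValiantsHypothesis.Theorems.FifoMatching.NNLinearDegreeCofactorHard.CondProbBits

variable {N : ℕ} (R : Finset (Fin N)) (H E : ℕ) (y : Fin N → Bool) (S : Finset (Fin N))

/-- The bit bookkeeping of `ShedWordDefs` and of `CondProbBits` agree. [folklore] -/
theorem bit_eq_bitAt (t : ℕ) : bit y t = bitAt y t := rfl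

/-- `pushes (prefix t) ≤ #openers` for `t ≤ N`. [folklore] -/
theorem pushes_le_card_openerSet {t : ℕ} (ht : t ≤ N) :
    pushes (shedPrefix R H E y t) ≤ (openerSet (shedWord R H E y)).card := by
  rw [← pushes_shedPrefix_N]; exact pushes_mono R H E y ht

/-! ### Between two gates with a push at the first lies a test -/

/-- **Between a failed gate and a later gate lies a test coin.** [folklore] -/
theorem exists_isTest_between (hbal : (closerSet (shedWord R H E y)).card = (openerSet (shedWord R H E y)).card)
    (hresp : ∀ i, i ∈ S ↔ fifo (shedWord R H E y) hbal i ∈ S) (hEN : E ≤ N) {w : ℕ} (hw : w ≤ freeCount R 0 H)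
    (hband : ∀ s, H ≤ s → s ≤ E → |fairWalk R H E y s| < w) {j j' : ℕ} (hjj' : j < j')
    (hg : isGate R H E y S j = true) (hpushj : shedLetter R H E y j = true) (hg' : isGate R H E y S j' = true) :
    ∃ t, j < t ∧ t < j' ∧ isTest R H E y S t = true := by
  classical
  have hfair := ((isGate_iff R H E y S j).1 hg).1
  have hfair' := ((isGate_iff R H E y S j').1 hg').1
  obtain ⟨hdj, hHj, hnej, hjE, hfrontj⟩ := (isFair_iff R H E y j).1 hfair
  obtain ⟨hdj', _, hnej', hj'E, hfrontj'⟩ := (isFair_iff R H E y j').1 hfair'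
  have hjN : j ≤ N := hjE.le.trans hEN
  have hj'N : j' ≤ N := hj'E.le.trans hEN
  obtain ⟨hpush, hchain, hcol, _, hcols⟩ := gate_data R H E y S hjN hg
  set k := pops (shedPrefix R H E y j) with hk
  set L := lookLenL R S (shedPrefix R H E y j) with hL
  have hL1 : 1 ≤ L := (lookLenL_spec R S (shedPrefix R H E y j)).1
  have hSk : isRItem R H E y k = false := by rw [hk, isRItem_pops R H E y hjN hnej]; exact hfrontj
  have hk1 : pops (shedPrefix R H E y (j + 1)) = k := pops_succ_of_push R H E y hpushj
  by_contra hno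
  have hno' : ∀ p, j < p → p < j' → isTest R H E y S p = false := fun p h1 h2 => by
    by_contra h; rw [Bool.not_eq_false] at h; exact hno ⟨p, h1, h2, h⟩
  -- at a non-defect position of `(j, j')` with front `k`, the colour is the front's
  have hcolour : ∀ p, j < p → p < j' → isDefect R p = false → pops (shedPrefix R H E y p) = k →
      posColour S p = posColour S (openTime R H E y k) := by
    intro p h1 h2 h3 h4
    have hfp : isFair R H E y p = true :=
      isFair_of R H E y hEN hw hband h3 (hHj.trans h1.le) (h2.trans hj'E) (by rw [h4]; exact hSk)
    rw [posColour_eq_of_not_isTest R H E y S (h2.le.trans hj'N) hfp (hno' p h1 h2), h4]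
  have hmono : k ≤ pops (shedPrefix R H E y j') := by rw [← hk1]; exact pops_mono R H E y hjj'
  rcases hmono.lt_or_eq with hgt | heq
  · -- Case B: the front `k` was popped at `τ ∈ (j, j')`
    have hkO : k < (openerSet (shedWord R H E y)).card := lt_of_lt_of_le hnej (pushes_le_card_openerSet R H E y hjN)
    set τ := closeTime R H E y hbal k with hτ
    have hjτ : j < τ := Nat.lt_of_succ_le ((le_closeTime_iff R H E y hbal hkO _).2 hk1.le)
    have hτj' : τ < j' := (closeTime_lt_iff R H E y hbal hkO _).2 hgt
    have hpopτ := shedLetter_closeTime R H E y hbal hkO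
    have hpopsτ := pops_closeTime R H E y hbal hkO
    obtain ⟨a, ha1, hja⟩ := exists_freeIter_eq R hjτ (isDefect_eq_false_of_pop R H E y hpopτ)
    have hLs : k + L ≤ pops (shedPrefix R H E y j') := by
      by_contra hlt
      rw [not_le] at hlt
      have h1 := (hchain (pops (shedPrefix R H E y j') - k) (by omega) (by omega)).1
      rw [Nat.add_sub_cancel' hmono, isRItem_pops R H E y hj'N hnej', hfrontj'] at h1
      exact Bool.noConfusion h1
    have eng := chain R H E y hEN hw hband (hHj.trans hjτ.le) hpopτ (L := L)
      (fun l h1 h2 => by rw [hpopsτ]; exact (hchain l h1 h2).1) hτj' hj'E hdj' (by rw [hpopsτ]; exact hLs)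
    refine no_two_goodExits (σq := fun b => posColour S (freeIter R j b)) (L := L) (a := a) hcol ha1 ?_ ?_ ?_ ?_
    · intro b hb
      rcases Nat.eq_zero_or_pos b with hb0 | hb0
      · subst hb0
        have := hcols 0 (Nat.zero_le _)
        rwa [add_zero] at this
      · have hpb : freeIter R j b < τ := by rw [← hja]; exact freeIter_lt_freeIter R hb
        apply hcolour _ (by have := freeIter_lt_freeIter R (t := j) hb0; rwa [freeIter_zero] at this)
          (hpb.trans hτj') (isDefect_freeIter R hb0)
        apply le_antisymm
        · rw [← hpopsτ]; exact pops_mono R H E y hpb.le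
        · rw [← hk1]
          exact pops_mono R H E y (Nat.succ_le_of_lt
            (by have := freeIter_lt_freeIter R (t := j) hb0; rwa [freeIter_zero] at this))
    · exact hcols L le_rfl
    · show posColour S (freeIter R j a) = _
      rw [hja, posColour_eq_of_pop R H E y S hbal hresp (hτj'.trans_le hj'N |>.trans_le le_rfl |> fun h =>
        lt_of_lt_of_le hτj' (hj'E.le.trans hEN)) hpopτ, hpopsτ]
    · intro l hl1 hl
      show posColour S (freeIter R j (a + l)) = _
      obtain ⟨_, hpl, hltl⟩ := eng l hl.le
      obtain ⟨hls, hpopl⟩ := hltl hl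
      rw [freeIter_add, hja, posColour_eq_of_pop R H E y S hbal hresp (hls.trans_le hj'N |> fun h =>
        lt_of_lt_of_le hls (hj'E.le.trans hEN)) hpopl, hpl, hpopsτ]
      exact (hchain l hl1 hl).2
  · -- Case A: the front is unchanged at `j'`
    obtain ⟨a, ha1, hja⟩ := exists_freeIter_eq R hjj' hdj'
    obtain ⟨_, _, _, _, hcols'⟩ := gate_data R H E y S hj'N hg'
    have hpush' : k + L < pushes (shedPrefix R H E y j') := lt_of_lt_of_le hpush (pushes_mono R H E y hjj'.le)
    -- the look-ahead length at `j'` is the same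
    have hL' : lookLenL R S (shedPrefix R H E y j') = L := by
      apply lookLenL_eq_of R S _ hL1
      · right; left
        rw [← heq, pcolL_eq R H E y S hj'N hpush', pcolL_eq R H E y S hj'N (by rw [heq]; exact hnej')]
        exact hcol
      · intro l hl1 hl
        have hlt : k + l < pushes (shedPrefix R H E y j') := by omega
        rw [← heq]
        refine ⟨hlt, ?_, ?_⟩
        · rw [pcolL_eq R H E y S hj'N hlt, pcolL_eq R H E y S hj'N (by rw [heq]; exact hnej')]
          exact (hchain l hl1 hl).2
        · rw [pRL_eq R H E y hj'N hlt]; exact (hchain l hl1 hl).1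
    rw [hL', ← heq] at hcols'
    refine no_two_goodExits (σq := fun b => posColour S (freeIter R j b)) (L := L) (a := a) hcol ha1 ?_ ?_ ?_ ?_
    · intro b hb
      rcases Nat.eq_zero_or_pos b with hb0 | hb0
      · subst hb0
        have := hcols 0 (Nat.zero_le _)
        rwa [add_zero] at this
      · have hjb : j < freeIter R j b := by
          have := freeIter_lt_freeIter R (t := j) hb0; rwa [freeIter_zero] at this
        have hpb : freeIter R j b < j' := by rw [← hja]; exact freeIter_lt_freeIter R hb
        apply hcolour _ hjb hpb (isDefect_freeIter R hb0)
        apply le_antisymm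
        · rw [heq]; exact pops_mono R H E y hpb.le
        · rw [← hk1]; exact pops_mono R H E y (Nat.succ_le_of_lt hjb)
    · exact hcols L le_rfl
    · show posColour S (freeIter R j a) = _
      rw [hja]
      have := hcols' 0 (Nat.zero_le _)
      rwa [freeIter_zero, add_zero] at this
    · intro l hl1 hl
      show posColour S (freeIter R j (a + l)) = _
      rw [freeIter_add, hja, hcols' l hl.le]
      exact (hchain l hl1 hl).2

/-- **`F ≤ T + 1`**: the failed gates of a respecting band word number at most its test coins plus one. [folklore] -/
theorem card_failedGates_le (hbal : (closerSet (shedWord R H E y)).card = (openerSet (shedWord R H E y)).card)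
    (hresp : ∀ i, i ∈ S ↔ fifo (shedWord R H E y) hbal i ∈ S) (hEN : E ≤ N) {w : ℕ} (hw : w ≤ freeCount R 0 H)
    (hband : ∀ s, H ≤ s → s ≤ E → |fairWalk R H E y s| < w) :
    ((range N).filter fun j => kind R H E S j y = 2 ∧ bitAt y j ≠ desig R H E S j y).card ≤
      ((range N).filter fun j => kind R H E S j y = 1).card + 1 := by
  classical
  apply card_le_card_add_one_of_between
  intro g hg g' hg' hlt
  rw [mem_filter, kind_eq_two_iff] at hg hg'
  obtain ⟨_, ⟨hng, hgg⟩, hbit⟩ := hg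
  obtain ⟨_, ⟨_, hgg'⟩, _⟩ := hg'
  have hpush : shedLetter R H E y g = true := by
    rw [shedLetter_of_isFair R H E y ((isGate_iff R H E y S g).1 hgg).1, bit_eq_bitAt]
    unfold desig at hbit
    rw [hng] at hbit
    simpa using hbit
  obtain ⟨t, h1, h2, h3⟩ := exists_isTest_between R H E y S hbal hresp hEN hw hband hlt hgg hpush hgg'
  have htE : t < E := h2.trans ((isFair_iff R H E y g').1 ((isGate_iff R H E y S g').1 hgg').1).2.2.2.1
  exact ⟨t, mem_filter.2 ⟨mem_range.2 (htE.trans_le hEN), (kind_eq_one_iff R H E S t y).2 h3⟩, h1, h2⟩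

end Summit.ValiantsHypothesis.ValiantsHypothesis.Theorems.FifoMatching.NNLinearDegreeCofactorHard.ShedWord

end
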